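/-
Copyright (c) 2026 the pub-hodgecm-mathlib formalisation cell (harness21).  Prover seat hodgecm-mathlib-K2Liu-p11 (g2), Track B «K2-LIT»,
#184♮ = hLiu418 = `stmt-HodgeConjecture-24832`; organ S2, LEAD F0P6-plan (g14) RULING M-158g road (γ): the «frozen factor» law for the (slot) binder of ★ (J-ii).
THEOREMS ONLY (no `def`, no `instance`, no notation, no named-fact hypothesis, no `sorry`); GENERIC over the ring `R` of ★ `K2LiuU22CompactPictureDefs`.
-/
import Summits.HodgeConjecture.HodgeConjecture.Theorems.K2LiuU22CompactPictureDefs     -- ★ DEFS leaf (p10): `dMat rOp lOp euler casimir pOp mOp`, generic `R`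
import Mathlib.Algebra.BigOperators.Group.Finset.Basic
import HarnessLib

/-!
# Crux `HLiu418`, road (γ): «★ FILE 1 READ AT ONE PLACE, THE OTHERS FROZEN» — the U(2,2) compact-picture operators commute with multiplication by `d`-constants

Cell `hodgecm-mathlib`, crux item hLiu418 = `stmt-HodgeConjecture-24832` (helper lane `--supports`, count-neutral).

On the multi-place carrier `R` (one commutative ℂ-algebra with per-place data `(d_w, u_w, Dinv_w)`, M-158g), an element `c` is FROZEN for the place `w` when every derivation
`d_w i j` kills it (e.g. any product of the other places' coordinates).  Then every ★ operator built from `(d_w, u_w, Dinv_w)` — `dMat`, `rOp`, `lOp`, `euler`, `casimir`, `pOp`,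
`mOp` — is `c`-linear: `Op (c * F) = c * Op F` (Leibniz).  Together with a slot map `φ_w` intertwining the one-place operator this is exactly the (slot) binder of ★ (J-ii)
`K2LiuSlotwiseSubmoduleInduction.mixed_prod_mem` — packaged as `slot_law_of_frozen`.
* §1 `deriv_mul_of_apply_eq_zero` (`d (c F) = c · d F`), `apply_prod_eq_zero` (derivations kill products of constants), `apply_mul_eq_zero`;
* §2 `dMat_mul_of_frozen`, `rOp_mul_of_frozen`, `lOp_mul_of_frozen`, `euler_mul_of_frozen`, `casimir_mul_of_frozen`, **`pOp_mul_of_frozen`**, **`mOp_mul_of_frozen`**;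
* §3 **`slot_law_of_frozen`** — from `Op (c * F) = c * Op F` for frozen `c`, an intertwining `Op (φ v) = φ (Op₀ v)` and frozen slot images, the (slot) identity
  `Op ((∏ j ∈ t, ψ j (b j)) * φ v) = (∏ j ∈ t, ψ j (b j)) * φ (Op₀ v)`.
References: [LeeZhu1998, §5 p. 5032]; [KashiwaraVergne1978, §II.5].
HONEST LABEL: HC_CM is proved only modulo the 7 printed citations (2 remaining named inputs: hLiu418 = stmt-HodgeConjecture-24832,
h413 = stmt-HodgeConjecture-24833) until rung 0 closes; count-neutral helper, closes no socket.
-/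

set_option autoImplicit false
set_option linter.dupNamespace false

namespace Summit.HodgeConjecture.HodgeConjecture.Cruxes.HLiu418.K2LiuU22OperatorsFrozenFactor

open Summit.HodgeConjecture.HodgeConjecture.Cruxes.HLiu418.K2LiuU22CompactPictureDefs

variable {R : Type*} [CommRing R] [Algebra ℂ R]

/-! ## §1  Derivations and frozen elements -/

/-- A derivation killing `c` is `c`-linear: `D (c F) = c · D F`. [folklore] -/
theorem deriv_mul_of_apply_eq_zero (D : Derivation ℂ R R) {c : R} (hc : D c = 0) (F : R) : D (c * F) = c * D F := by
  rw [Derivation.leibniz, hc, smul_zero, add_zero, smul_eq_mul]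

/-- A derivation killing `a` and `b` kills `a * b`. [folklore] -/
theorem apply_mul_eq_zero (D : Derivation ℂ R R) {a b : R} (ha : D a = 0) (hb : D b = 0) : D (a * b) = 0 := by
  rw [Derivation.leibniz, ha, hb, smul_zero, smul_zero, add_zero]

/-- A derivation killing every factor kills the product. [folklore] -/
theorem apply_prod_eq_zero {ι : Type*} (D : Derivation ℂ R R) (t : Finset ι) (x : ι → R) (hx : ∀ j ∈ t, D (x j) = 0) : D (∏ j ∈ t, x j) = 0 := by
  classical
  induction t using Finset.induction_on with
  | empty => simp
  | @insert a s ha ih =>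
    rw [Finset.prod_insert ha]
    exact apply_mul_eq_zero D (hx a (Finset.mem_insert_self a s)) (ih fun j hj => hx j (Finset.mem_insert_of_mem hj))

/-! ## §2  The operators are linear over frozen elements -/

variable (d : Fin 2 → Fin 2 → Derivation ℂ R R) (u : Matrix (Fin 2) (Fin 2) R) (Dinv : R)

/-- `d_Y (c F) = c · d_Y F` for frozen `c`. [LeeZhu1998, §5] -/
theorem dMat_mul_of_frozen (Y : Matrix (Fin 2) (Fin 2) R) {c : R} (hc : ∀ i j, d i j c = 0) (F : R) : dMat d Y (c * F) = c * dMat d Y F := by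
  rw [dMat_apply, dMat_apply, Finset.mul_sum]
  refine Finset.sum_congr rfl fun i _ => ?_
  rw [Finset.mul_sum]
  refine Finset.sum_congr rfl fun j _ => ?_
  rw [deriv_mul_of_apply_eq_zero (d i j) (hc i j)]
  ring

/-- `R_{ab} (c F) = c · R_{ab} F` for frozen `c`. [LeeZhu1998, §5] -/
theorem rOp_mul_of_frozen (a b : Fin 2) {c : R} (hc : ∀ i j, d i j c = 0) (F : R) : rOp d u a b (c * F) = c * rOp d u a b F := by
  rw [rOp_apply, rOp_apply, Finset.mul_sum]
  refine Finset.sum_congr rfl fun k _ => ?_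
  rw [deriv_mul_of_apply_eq_zero (d k b) (hc k b)]
  ring

/-- `L_{ab} (c F) = c · L_{ab} F` for frozen `c`. [LeeZhu1998, §5] -/
theorem lOp_mul_of_frozen (a b : Fin 2) {c : R} (hc : ∀ i j, d i j c = 0) (F : R) : lOp d u a b (c * F) = c * lOp d u a b F := by
  rw [lOp_apply, lOp_apply, Finset.mul_sum]
  refine Finset.sum_congr rfl fun k _ => ?_
  rw [deriv_mul_of_apply_eq_zero (d a k) (hc a k)]
  ring

/-- `E (c F) = c · E F` for frozen `c`. [KashiwaraVergne1978, §II.5] -/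
theorem euler_mul_of_frozen {c : R} (hc : ∀ i j, d i j c = 0) (F : R) : euler d u (c * F) = c * euler d u F :=
  dMat_mul_of_frozen d u hc F

/-- `C (c F) = c · C F` for frozen `c` (the Casimir is a composite of the `R_{ab}`). [LeeZhu1998, §5] -/
theorem casimir_mul_of_frozen {c : R} (hc : ∀ i j, d i j c = 0) (F : R) : casimir d u (c * F) = c * casimir d u F := by
  rw [casimir_apply, casimir_apply, Finset.mul_sum]
  refine Finset.sum_congr rfl fun a _ => ?_
  rw [Finset.mul_sum]
  refine Finset.sum_congr rfl fun b _ => ?_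
  rw [rOp_mul_of_frozen d u b a hc, rOp_mul_of_frozen d u a b hc]

/-- **`P_{ab} (c F) = c · P_{ab} F`** for frozen `c` (Weil's `𝔭⁺` operator). [LeeZhu1998, §5 p. 5032] -/
theorem pOp_mul_of_frozen (p : ℂ) (a b : Fin 2) {c : R} (hc : ∀ i j, d i j c = 0) (F : R) :
    pOp d u Dinv p a b (c * F) = c * pOp d u Dinv p a b F := by
  have h1 : Dinv * u.adjugate b a * (c * F) = c * (Dinv * u.adjugate b a * F) := by ring
  rw [pOp_apply, pOp_apply, deriv_mul_of_apply_eq_zero (d a b) (hc a b), mul_sub, mul_smul_comm, h1]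

/-- **`M_{ab} (c F) = c · M_{ab} F`** for frozen `c` (Weil's `𝔭⁻` operator). [LeeZhu1998, §5 p. 5032] -/
theorem mOp_mul_of_frozen (q : ℂ) (a b : Fin 2) {c : R} (hc : ∀ i j, d i j c = 0) (F : R) :
    mOp d u q a b (c * F) = c * mOp d u q a b F := by
  have h1 : u b a * (c * F) = c * (u b a * F) := by ring
  rw [mOp_apply, mOp_apply, mul_add, Finset.mul_sum, mul_smul_comm, h1]
  congr 1
  · refine Finset.sum_congr rfl fun i _ => ?_
    rw [Finset.mul_sum]
    refine Finset.sum_congr rfl fun j _ => ?_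
    rw [deriv_mul_of_apply_eq_zero (d i j) (hc i j)]
    ring

/-! ## §3  Packaging: the (slot) identity of ★ (J-ii) -/

/-- **THE (slot) LAW FROM THE FROZEN-FACTOR LAW + AN INTERTWINING.**  Let `Op : R →ₗ[ℂ] R` be `c`-linear for every `c` killed by the derivations `d i j` (any of §2), let
`φ : A →ₗ[ℂ] R` intertwine a one-place operator `Op₀` (`Op (φ v) = φ (Op₀ v)`), and let the other slots' images `ψ j (b j)` (`j ∈ t`) be killed by every `d i j`.  Then
`Op ((∏ j ∈ t, ψ j (b j)) * φ v) = (∏ j ∈ t, ψ j (b j)) * φ (Op₀ v)` — the binder `hslot` of ★ `K2LiuSlotwiseSubmoduleInduction.mixed_prod_mem` at this operator.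
[LeeZhu1998, §5] -/
theorem slot_law_of_frozen {ι : Type*} {A : Type*} [AddCommGroup A] [Module ℂ A] {B : ι → Type*} (Op : R →ₗ[ℂ] R)
    (hOp : ∀ c : R, (∀ i j, d i j c = 0) → ∀ F, Op (c * F) = c * Op F) (φ : A →ₗ[ℂ] R) (Op₀ : A →ₗ[ℂ] A) (hφ : ∀ v, Op (φ v) = φ (Op₀ v))
    (ψ : ∀ j : ι, B j → R) (t : Finset ι) (hψ : ∀ j ∈ t, ∀ (x : B j) (i k : Fin 2), d i k (ψ j x) = 0) (b : Π j, B j) (v : A) :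
    Op ((∏ j ∈ t, ψ j (b j)) * φ v) = (∏ j ∈ t, ψ j (b j)) * φ (Op₀ v) := by
  rw [hOp _ (fun i k => apply_prod_eq_zero (d i k) t (fun j => ψ j (b j)) fun j hj => hψ j hj (b j) i k), hφ]

/-- The same with `pOp` named (the form p05's FILE 3 ∕ p16 plug). [LeeZhu1998, §5 p. 5032] -/
theorem slot_law_pOp {ι : Type*} {A : Type*} [AddCommGroup A] [Module ℂ A] {B : ι → Type*} (p : ℂ) (a b : Fin 2) (φ : A →ₗ[ℂ] R) (Op₀ : A →ₗ[ℂ] A)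
    (hφ : ∀ v, pOp d u Dinv p a b (φ v) = φ (Op₀ v)) (ψ : ∀ j : ι, B j → R) (t : Finset ι) (hψ : ∀ j ∈ t, ∀ (x : B j) (i k : Fin 2), d i k (ψ j x) = 0)
    (bb : Π j, B j) (v : A) :
    pOp d u Dinv p a b ((∏ j ∈ t, ψ j (bb j)) * φ v) = (∏ j ∈ t, ψ j (bb j)) * φ (Op₀ v) :=
  slot_law_of_frozen d (pOp d u Dinv p a b) (fun _ hc F => pOp_mul_of_frozen d u Dinv p a b hc F) φ Op₀ hφ ψ t hψ bb v

/-- The same with `mOp` named. [LeeZhu1998, §5 p. 5032] -/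
theorem slot_law_mOp {ι : Type*} {A : Type*} [AddCommGroup A] [Module ℂ A] {B : ι → Type*} (q : ℂ) (a b : Fin 2) (φ : A →ₗ[ℂ] R) (Op₀ : A →ₗ[ℂ] A)
    (hφ : ∀ v, mOp d u q a b (φ v) = φ (Op₀ v)) (ψ : ∀ j : ι, B j → R) (t : Finset ι) (hψ : ∀ j ∈ t, ∀ (x : B j) (i k : Fin 2), d i k (ψ j x) = 0)
    (bb : Π j, B j) (v : A) :
    mOp d u q a b ((∏ j ∈ t, ψ j (bb j)) * φ v) = (∏ j ∈ t, ψ j (bb j)) * φ (Op₀ v) :=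
  slot_law_of_frozen d (mOp d u q a b) (fun _ hc F => mOp_mul_of_frozen d u q a b hc F) φ Op₀ hφ ψ t hψ bb v

/-- The same with `lOp` ∕ `rOp` named. [LeeZhu1998, §5 p. 5032] -/
theorem slot_law_lOp_rOp {ι : Type*} {A : Type*} [AddCommGroup A] [Module ℂ A] {B : ι → Type*} (a b : Fin 2) (φ : A →ₗ[ℂ] R) (L₀ R₀ : A →ₗ[ℂ] A)
    (hφL : ∀ v, lOp d u a b (φ v) = φ (L₀ v)) (hφR : ∀ v, rOp d u a b (φ v) = φ (R₀ v)) (ψ : ∀ j : ι, B j → R) (t : Finset ι)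
    (hψ : ∀ j ∈ t, ∀ (x : B j) (i k : Fin 2), d i k (ψ j x) = 0) (bb : Π j, B j) (v : A) :
    lOp d u a b ((∏ j ∈ t, ψ j (bb j)) * φ v) = (∏ j ∈ t, ψ j (bb j)) * φ (L₀ v) ∧
      rOp d u a b ((∏ j ∈ t, ψ j (bb j)) * φ v) = (∏ j ∈ t, ψ j (bb j)) * φ (R₀ v) :=
  ⟨slot_law_of_frozen d (lOp d u a b) (fun _ hc F => lOp_mul_of_frozen d u a b hc F) φ L₀ hφL ψ t hψ bb v,
    slot_law_of_frozen d (rOp d u a b) (fun _ hc F => rOp_mul_of_frozen d u a b hc F) φ R₀ hφR ψ t hψ bb v⟩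

end Summit.HodgeConjecture.HodgeConjecture.Cruxes.HLiu418.K2LiuU22OperatorsFrozenFactor
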